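import Literature.AlgebraicGeometry.GroupSchemes.CartierDualFiniteFlat
import Literature.AlgebraicGeometry.GroupSchemes.AffineGroupSchemeBialgHom
import Literature.AlgebraicGeometry.GroupSchemes.AffineGroupSchemeIsoSpec
import Literature.RingTheory.HopfAlgebra.FiniteDualTranspose
import Literature.RingTheory.HopfAlgebra.FiniteDualBidual
import HarnessLib

/-!
# Cartier duality: the bidual `(G^D)^D ≅ G` as group schemes (Tate 1997 §(3.8); Görtz–Wedhorn II §(27.2))

Layer `Literature/AlgebraicGeometry/GroupSchemes`, namespace `Literature.AlgebraicGeometry.GroupSchemes.AffineGroupScheme` (continues ★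
`CartierDualFiniteFlat` p845244 (+ ED. 2: instances on `cartierDual G`, so `(G^D)^D` elaborates), ★ `AffineGroupSchemeBialgHom` p845266
(`isMonHom_specOverMapOfAlgHom`), ★ `AffineGroupSchemeIsoSpec` p845351 (`isMonHom_isoSpecOver_inv`), ★ `AffineGroupSchemeHopfAlgebraRoundTrip` p845217
(`algSpecOverBialgEquiv`), ★ CD2-bidual `FiniteDualBidual` (`bidualMap_*`) and ★ CD3-equiv `FiniteDualTranspose` (`transposeBialgEquiv`)).  DEFINITIONS
(`algCartierDualBialgEquiv`, `evalDualAlg`, `bidualBialgEquiv`, `bidualAlgEquiv`, `bidualSpecHom ∕ Inv`, `cartierDualBidualIso`) + theorems; no instance, no notation, no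
named fact, no `sorry`.  Cell `hodgecm-mathlib` (D-0151), programme P6 «MOD», HEART organ (g1) «scheme dress of Cartier duality», FILE 5b (last) of the
B-p04 (g37) plan.  Count-neutral Mathlib-side capital: HC_CM is proved only modulo the 7 printed citations until rung 0 closes; nothing here bears on it.

THE PRINT ([Tate1997FiniteFlatGroupSchemes] §(3.8) p. 145: «the canonical map `A → A″` is an isomorphism of Hopf algebras, so `G ≃ (G^D)^D`»;
[GortzWedhorn2023] §(27.2)).  For a finite free commutative group scheme `G = Spec A` over `R`:

* §1 **`algCartierDualBialgEquiv G : Alg (cartierDual G) ≃ₐc[R] DualAlg G`** — `Γ(G^D, 𝒪) ≃ A^*` as BIALGEBRAS (★ `algSpecOverBialgEquiv` at `H := A^*`).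
* §2 **`evalDualAlg G : Alg G →ₗ[R] (A^*)^*`** (`a ↦ (f ↦ f a)`, `evalDualAlg_apply_apply`) and **`bidualBialgEquiv G : Alg G ≃ₐc[R] (A^*)^*`** — Tate's
  `A ≃ A″` with the CONCRETE evaluation map (★ CD2-bidual `bidualMap_mul ∕ counit_bidualMap ∕ map_bidualMap_comp_comul ∕ bidualMap_bijective`).
* §3 **`bidualAlgEquiv G : Alg G ≃ₐc[R] DualAlg (cartierDual G)`** — `A ≃ Γ((G^D)^D-algebra) = Γ(G^D)^*`, the composite of §2 with the transpose of §1
  (★ `transposeBialgEquiv`); `bidualAlgEquiv_apply_apply : (Φ a)(y) = (Γ(G^D) ≅ A^*)(y)(a)` — the evaluation pairing.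
* §4 **`cartierDualBidualIso G : cartierDual (cartierDual G) ≅ G`** (`Spec Φ` followed by `Spec A ≅ G`) and HEAD **`isMonHom_cartierDualBidualIso_hom`**:
  it is an isomorphism of GROUP schemes (`Spec` of a bialgebra equivalence is a homomorphism, ★ `isMonHom_specOverMapOfAlgHom`; `Spec A ≅ G` is one,
  ★ `isMonHom_isoSpecOver_inv`) — CARTIER DUALITY `G ≅ (G^D)^D`.

## References
* [Tate1997FiniteFlatGroupSchemes] J. Tate, *Finite flat group schemes*, in: Modular Forms and Fermat's Last Theorem (1997), §(3.8) pp. 144–146.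
* [GortzWedhorn2023] U. Görtz, T. Wedhorn, *Algebraic Geometry II* (2023), §(27.2), (27.2.1), Def. 27.6 (pp. 606–607).
-/

set_option autoImplicit false

-- Mathlib's `Over`/`Scheme` APIs are stated across semireducible wrappers (as in the ★ `GroupSchemes/*` files).
set_option backward.isDefEq.respectTransparency false

universe u

open CategoryTheory CategoryTheory.Limits AlgebraicGeometry MonoidalCategory CartesianMonoidalCategory TensorProduct WithConv

noncomputable section

namespace Literature.AlgebraicGeometry.GroupSchemes

namespace AffineGroupScheme

open scoped MonObj

open Literature.AlgebraicGeometry.Motives Literature.NumberTheory.DiophantineGeometry Literature.RingTheory.HopfAlgebra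

variable {R : Type u} [CommRing R] (G : SchemeOver R) [GrpObj G] [IsCommMonObj G] [IsAffine G.left]
  [Module.Free R (Alg G)] [Module.Finite R (Alg G)]

/-! ## §1 `Γ(G^D, 𝒪) ≃ Γ(G, 𝒪)^*` as bialgebras -/

/-- **`Γ(G^D, 𝒪) ≃ₐc[R] A^*`**: the global sections of the Cartier dual, with the Hopf structure of the group scheme `G^D` (★ `cartierDual.instGrpObj`
= `grpObjOfHopfAlgebra R (DualAlg G)`), ARE the dual Hopf algebra `A^* = DualAlg G` (★ `algSpecOverBialgEquiv`, the round trip `Γ(Spec H) ≃ₐc H`).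
[cite: Tate1997FiniteFlatGroupSchemes, §(3.8) p. 145] -/
def algCartierDualBialgEquiv : Alg (cartierDual G) ≃ₐc[R] DualAlg G :=
  haveI : IsAffine (specOver R (DualAlg G)).left := isAffine_specOver_left (DualAlg G)
  algSpecOverBialgEquiv R (DualAlg G)

/-- `algCartierDualBialgEquiv` is `algCartierDualEquiv` (= `Scheme.ΓSpecIso`) on elements. [cite: Tate1997FiniteFlatGroupSchemes, §(3.8) p. 145] -/
theorem algCartierDualBialgEquiv_apply (a : Alg (cartierDual G)) : algCartierDualBialgEquiv G a = algCartierDualEquiv G a := rfl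

/-! ## §2 The evaluation map `A → (A^*)^*` is a bialgebra equivalence (Tate: `A ≃ A″`) -/

/-- **The evaluation map `a ↦ (f ↦ f a)`**, `A → (A^*)^*` (Mathlib `Module.Dual.eval`, read on the `WithConv` carriers as in ★ CD2-bidual
`exists_bidualMap`). [cite: Tate1997FiniteFlatGroupSchemes, §(3.8) p. 145] -/
def evalDualAlg : Alg G →ₗ[R] WithConv (Module.Dual R (DualAlg G)) :=
  (WithConv.linearEquiv R (Module.Dual R (WithConv (Module.Dual R (Alg G))))).symm.toLinearMap ∘ₗ
    (Module.Dual.congr (WithConv.linearEquiv R (Module.Dual R (Alg G))).symm).toLinearMap ∘ₗ Module.Dual.eval R (Alg G)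

omit [Module.Free R (Alg G)] [Module.Finite R (Alg G)] in
/-- `(evalDualAlg G a) f = f a`. [cite: Tate1997FiniteFlatGroupSchemes, §(3.8) p. 145] -/
theorem evalDualAlg_apply_apply (a : Alg G) (f : WithConv (Module.Dual R (Alg G))) : evalDualAlg G a f = f a := rfl

/-- **HEAD (algebra) — `A ≃ₐc[R] (A^*)^*` by evaluation** (Tate: «the canonical map `A → A″` is an isomorphism of Hopf algebras»), for the
dual bialgebra structure `FiniteDual.bialgebra R (DualAlg G)` on `(A^*)^*`; every field is a ★ CD2-bidual theorem at `β := evalDualAlg G`.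
[cite: Tate1997FiniteFlatGroupSchemes, §(3.8) p. 145] -/
def bidualBialgEquiv : letI := FiniteDual.bialgebra R (DualAlg G); Alg G ≃ₐc[R] WithConv (Module.Dual R (DualAlg G)) :=
  letI := FiniteDual.bialgebra R (DualAlg G)
  have hβ : ∀ (x : Alg G) (f : WithConv (Module.Dual R (Alg G))), (evalDualAlg G x) f = f x := fun _ _ => rfl
  have hbij := bidualMap_bijective hβ
  { toFun := evalDualAlg G
    map_add' := (evalDualAlg G).map_add
    map_smul' := (evalDualAlg G).map_smul
    counit_comp := LinearMap.ext fun x => counit_bidualMap hβ x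
    map_comp_comul := map_bidualMap_comp_comul hβ
    invFun := (Equiv.ofBijective _ hbij).symm
    left_inv := (Equiv.ofBijective _ hbij).left_inv
    right_inv := (Equiv.ofBijective _ hbij).right_inv
    map_mul' := fun x y => bidualMap_mul hβ x y }

/-- `bidualBialgEquiv` is `evalDualAlg` on elements. [cite: Tate1997FiniteFlatGroupSchemes, §(3.8) p. 145] -/
theorem bidualBialgEquiv_apply (a : Alg G) : letI := FiniteDual.bialgebra R (DualAlg G); bidualBialgEquiv G a = evalDualAlg G a := rfl

/-! ## §3 `A ≃ Γ(G^D, 𝒪)^*` — the algebra of `(G^D)^D` -/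

/-- **`Φ : A ≃ₐc[R] Γ(G^D, 𝒪)^* = DualAlg (G^D)`**: the evaluation isomorphism `A ≃ (A^*)^*` followed by the transpose of `Γ(G^D) ≃ₐc A^*`
(★ `transposeBialgEquiv`).  `Spec Φ` is the bidual isomorphism of §4. [cite: Tate1997FiniteFlatGroupSchemes, §(3.8) p. 145] -/
def bidualAlgEquiv : Alg G ≃ₐc[R] DualAlg (cartierDual G) :=
  letI := FiniteDual.bialgebra R (DualAlg G)
  (bidualBialgEquiv G).trans (FiniteDual.transposeBialgEquiv (algCartierDualBialgEquiv G))

/-- **The bidual identification is the evaluation pairing**: `(Φ a)(y) = ⟨y, a⟩ := (Γ(G^D) ≅ A^*)(y)(a)` for `a ∈ A`, `y ∈ Γ(G^D, 𝒪)`.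
[cite: Tate1997FiniteFlatGroupSchemes, §(3.8) p. 145] -/
theorem bidualAlgEquiv_apply_apply (a : Alg G) (y : Alg (cartierDual G)) :
    WithConv.ofConv (bidualAlgEquiv G a) y = WithConv.ofConv (algCartierDualEquiv G y) a := rfl

/-- `Φ ∘ Φ⁻¹ = id` as algebra maps. [cite: Tate1997FiniteFlatGroupSchemes, §(3.8) p. 145] -/
theorem bidualAlgEquiv_comp_symm :
    ((bidualAlgEquiv G : Alg G →ₐc[R] DualAlg (cartierDual G)) : Alg G →ₐ[R] DualAlg (cartierDual G)).comp
        ((bidualAlgEquiv G).symm : DualAlg (cartierDual G) →ₐc[R] Alg G) = AlgHom.id R (DualAlg (cartierDual G)) :=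
  AlgHom.ext fun b => (bidualAlgEquiv G).apply_symm_apply b

/-- `Φ⁻¹ ∘ Φ = id` as algebra maps. [cite: Tate1997FiniteFlatGroupSchemes, §(3.8) p. 145] -/
theorem bidualAlgEquiv_symm_comp :
    (((bidualAlgEquiv G).symm : DualAlg (cartierDual G) →ₐc[R] Alg G) : DualAlg (cartierDual G) →ₐ[R] Alg G).comp
        (bidualAlgEquiv G : Alg G →ₐc[R] DualAlg (cartierDual G)) = AlgHom.id R (Alg G) :=
  AlgHom.ext fun a => (bidualAlgEquiv G).symm_apply_apply a

/-! ## §4 `(G^D)^D ≅ G` as group schemes -/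

section SpecLemmas

variable {H₁ H₂ H₃ : Type u} [CommRing H₁] [Algebra R H₁] [CommRing H₂] [Algebra R H₂] [CommRing H₃] [Algebra R H₃]

omit G in
/-- `Spec` of a composite of `R`-algebra maps (over a commutative RING `R`; cf. ★ `specOverMapOfAlgHom_comp` over a field).
[cite: GortzWedhorn2023, §(27.2) (p. 606)] -/
private theorem specOverMapOfAlgHom_comp' (ψ₁ : H₁ →ₐ[R] H₂) (ψ₂ : H₂ →ₐ[R] H₃) :
    AlgPoints.specOverMapOfAlgHom ψ₂ ≫ AlgPoints.specOverMapOfAlgHom ψ₁ = AlgPoints.specOverMapOfAlgHom (ψ₂.comp ψ₁) := by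
  apply Over.OverMorphism.ext
  rw [Over.comp_left, AlgPoints.specOverMapOfAlgHom_left, AlgPoints.specOverMapOfAlgHom_left, AlgPoints.specOverMapOfAlgHom_left]
  exact (Spec.map_comp (CommRingCat.ofHom ψ₁.toRingHom) (CommRingCat.ofHom ψ₂.toRingHom)).symm

omit G in
/-- `Spec` of the identity (over a commutative RING `R`). [cite: GortzWedhorn2023, §(27.2) (p. 606)] -/
private theorem specOverMapOfAlgHom_id' : AlgPoints.specOverMapOfAlgHom (AlgHom.id R H₁) = 𝟙 (specOver R H₁) := by
  apply Over.OverMorphism.ext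
  rw [AlgPoints.specOverMapOfAlgHom_left, Over.id_left]
  exact Spec.map_id _

end SpecLemmas

/-- **`Spec Φ : (G^D)^D → Spec Γ(G, 𝒪)`** (`(G^D)^D = Spec Γ(G^D)^*` by ★ `cartierDual_cartierDual_def`). [cite: Tate1997FiniteFlatGroupSchemes, §(3.8) p. 145] -/
def bidualSpecHom : cartierDual (cartierDual G) ⟶ specOver R (Alg G) :=
  AlgPoints.specOverMapOfAlgHom ((bidualAlgEquiv G : Alg G →ₐc[R] DualAlg (cartierDual G)) : Alg G →ₐ[R] DualAlg (cartierDual G))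

/-- **`Spec Φ⁻¹ : Spec Γ(G, 𝒪) → (G^D)^D`.** [cite: Tate1997FiniteFlatGroupSchemes, §(3.8) p. 145] -/
def bidualSpecInv : specOver R (Alg G) ⟶ cartierDual (cartierDual G) :=
  AlgPoints.specOverMapOfAlgHom (((bidualAlgEquiv G).symm : DualAlg (cartierDual G) →ₐc[R] Alg G) : DualAlg (cartierDual G) →ₐ[R] Alg G)

/-- `Spec Φ ≫ Spec Φ⁻¹ = 𝟙`. [cite: Tate1997FiniteFlatGroupSchemes, §(3.8) p. 145] -/
theorem bidualSpecHom_comp_inv : bidualSpecHom G ≫ bidualSpecInv G = 𝟙 (cartierDual (cartierDual G)) := by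
  change AlgPoints.specOverMapOfAlgHom _ ≫ AlgPoints.specOverMapOfAlgHom _ = 𝟙 (specOver R (DualAlg (cartierDual G)))
  rw [specOverMapOfAlgHom_comp', bidualAlgEquiv_comp_symm, specOverMapOfAlgHom_id']

/-- `Spec Φ⁻¹ ≫ Spec Φ = 𝟙`. [cite: Tate1997FiniteFlatGroupSchemes, §(3.8) p. 145] -/
theorem bidualSpecInv_comp_hom : bidualSpecInv G ≫ bidualSpecHom G = 𝟙 (specOver R (Alg G)) := by
  change AlgPoints.specOverMapOfAlgHom _ ≫ AlgPoints.specOverMapOfAlgHom _ = 𝟙 (specOver R (Alg G))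
  rw [specOverMapOfAlgHom_comp', bidualAlgEquiv_symm_comp, specOverMapOfAlgHom_id']

/-- **`Spec Φ` is a homomorphism** from `(G^D)^D` (★ `cartierDual.instGrpObj`) to `Spec Γ(G)` with the Hopf-algebra group structure
★ `grpObjOfHopfAlgebra R (Alg G)` (★ `isMonHom_specOverMapOfAlgHom`: `Φ` is a bialgebra map). [cite: Tate1997FiniteFlatGroupSchemes, §(3.8) p. 145] -/
theorem isMonHom_bidualSpecHom : letI : GrpObj (specOver R (Alg G)) := grpObjOfHopfAlgebra R (Alg G); IsMonHom (bidualSpecHom G) :=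
  isMonHom_specOverMapOfAlgHom R (bidualAlgEquiv G : Alg G →ₐc[R] DualAlg (cartierDual G))

/-- **The Cartier bidual isomorphism `(G^D)^D ≅ G`**: `Spec Φ : (G^D)^D = Spec Γ(G^D)^* → Spec A` (inverse `Spec Φ⁻¹`) followed by
`Spec A ≅ G` (★ `isoSpecOver`). [cite: Tate1997FiniteFlatGroupSchemes, §(3.8) p. 145] -/
def cartierDualBidualIso : cartierDual (cartierDual G) ≅ G :=
  { hom := bidualSpecHom G
    inv := bidualSpecInv G
    hom_inv_id := bidualSpecHom_comp_inv G
    inv_hom_id := bidualSpecInv_comp_hom G } ≪≫ (isoSpecOver G).symm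

/-- The morphism of the bidual isomorphism is `Spec Φ ≫ (Spec A ≅ G)`. [cite: Tate1997FiniteFlatGroupSchemes, §(3.8) p. 145] -/
theorem cartierDualBidualIso_hom : (cartierDualBidualIso G).hom = bidualSpecHom G ≫ (isoSpecOver G).inv := rfl

/-- **HEAD — CARTIER DUALITY: `(G^D)^D ≅ G` is an isomorphism of GROUP schemes** (`G^D`, `(G^D)^D` with the group structures
★ `cartierDual.instGrpObj`): `Spec Φ` is a homomorphism because `Φ` is a bialgebra map (★ `isMonHom_specOverMapOfAlgHom`) and
`Spec A ≅ G` is one (★ `isMonHom_isoSpecOver_inv`).  [Tate1997FiniteFlatGroupSchemes] §(3.8) p. 145: «`G ≃ (G^D)^D`».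
[cite: Tate1997FiniteFlatGroupSchemes, §(3.8) p. 145] -/
theorem isMonHom_cartierDualBidualIso_hom : IsMonHom (cartierDualBidualIso G).hom := by
  letI : GrpObj (specOver R (Alg G)) := grpObjOfHopfAlgebra R (Alg G)
  haveI h1 : IsMonHom (bidualSpecHom G) := isMonHom_bidualSpecHom G
  haveI h2 : IsMonHom (isoSpecOver G).inv := isMonHom_isoSpecOver_inv G
  rw [cartierDualBidualIso_hom]
  infer_instance

/-- … and so is its inverse `G ≅ (G^D)^D`. [cite: Tate1997FiniteFlatGroupSchemes, §(3.8) p. 145] -/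
theorem isMonHom_cartierDualBidualIso_inv : IsMonHom (cartierDualBidualIso G).inv := by
  haveI := isMonHom_cartierDualBidualIso_hom G
  infer_instance

end AffineGroupScheme

end Literature.AlgebraicGeometry.GroupSchemes

end
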